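import Summits.QuantumFields.BalabanUV.Beta.FP.CoarseCovarianceInverseKernel
import Summits.QuantumFields.BalabanUV.Beta.FP.BrillouinRadial
import Literature.MathematicalPhysics.QuantumFieldTheory.Balaban1983to89.Beta.VolumePeriodise

/-!
# `BalabanUV.Beta.FP.LatticeKernelSliceMoments` — road «FP» for binder row D1, leaf (H2), row H2V-4 (N) part 1∕2 ([folklore] engine of
# `FP/PerfectHessianColumnMoments`): THE ZEROTH, FIRST AND PURE SECOND MOMENTS OF THE LATTICE KERNEL OF A STRIP-REGULAR SYMBOL ARE THE VALUE AND THE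
# FIRST TWO SLICE DERIVATIVES OF THE SYMBOL AT THE ORIGIN — the Fourier series on a coordinate slice differentiated twice under the sum

HONEST DEPENDENCY (page 1, mandatory): continuum YM on T⁴ ⇐ BetaPertH ∧ nine spine estimates (0/9 proved); BetaPertH ⇐ (D1) ∧ (D4) ∧ CAP+tail;
G-an2-4 gates asym, D1 and NE2/3/4.  HONEST FRAMING (cell contract, verbatim): «discharging `BetaPertH` makes Bałaban's UV stability UNCONDITIONAL —
a real constructive-QFT result; it is NOT the continuum limit and NOT the Clay problem.»  THIS MODULE DISCHARGES NOTHING of the wall: it is [folklore]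
Fourier analysis on `[-π,π]^{d+1}` about an ARBITRARY strip-regular symbol `A` (`B4ContourShift.StripRegular A κ M`, `κ > 0`): the absolutely convergent
Fourier series `Σ_m K[A](m)·e^{−ip·m} = A(p)` (`CoarseCovarianceInverseKernel.hasSum_latticeKernel_cexp`, exponential decay `latticeKernel_decay`) restricted
to the coordinate slice `p = t·e_i` and differentiated twice in `t` under the sum (Mathlib `hasDerivAt_tsum`), the slice being holomorphic on the open
rectangle (`StripRegular.diff`).  WHY A (SMALL) GENERIC ENGINE (R-FP-33 (c) clause, owner INTENT journal l.27424): the road instance — the column moments of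
the perfect Hessian `Δ_∞` in `FP/PerfectHessianColumnMoments` — cannot be written without it, and the tree's Fourier layer has the inversion
(`hasSum_latticeKernel_cexp`) and the power-decay IBP (`FourierSliceIBP`) but no moment ∕ derivative dictionary; kept as a sibling file only for the
400-line limit.  No road object, no `def`, no `def … : Prop`, no cited fact, 0 sorry; 0∕4 row-D1 binders; NOT D1, NOT BetaPertH, NOT continuum, NOT Clay.

ABSOLUTE RULE (cell charter, verbatim): «No internally-minted statement may enter as a cited fact. Every hypothesis is either kernel-proved in this package or a
verbatim quotation of a PUBLISHED theorem with page reference. The manuscript(s) under audit are NOT citable for their own disputed steps — they are the thing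
under adjudication; programme-internal (2001/route/tribunal) claims are never citable.»

WHAT (all [folklore]; `K := latticeKernel A`, slice `z ↦ A (i.insertNth z 0)` through the origin in coordinate `i`):
* `norm_latticeKernel_le_exp_l1` (`‖K m‖ ≤ M·e^{−(κ/(d+1))|m|₁}`), `summable_norm_latticeKernel_mul_sq` (`Σ_m ‖K m‖·(|m|₁² + 1) < ∞`);
* `hasSum_latticeKernel_slice` (`Σ_m K m·e^{−itm_i} = A(t e_i)`, `|t| ≤ π`), **`hasSum_latticeKernel_zero`** (`Σ_m K m = A 0`);
* `hasDerivAt_sliceSeries`, `hasDerivAt_sliceSeries_deriv` (termwise first and second `t`-derivatives), `analyticAt_slice`, `sliceSeries_deriv_eq`,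
  `sliceSeries_deriv_deriv_eq` (identification with the slice's complex derivatives, `|t| < π`);
* **`hasSum_latticeKernel_mul_coord`** (`Σ_m K m·m_i = I·(slice)′(0)`), **`hasSum_latticeKernel_mul_coord_sq`** (`Σ_m K m·m_i² = −(slice)″(0)`).
Provenance: road FP OWNER b2b-balaban-beta-d1-p3 gen 9 (prover-b2b-balaban-beta-d1-p3-g9-0), 2026-08-21.  «not in print; our bookkeeping».
-/

noncomputable section

namespace Summit.QuantumFields.BalabanUV.Beta.FP.LatticeKernelSliceMoments

open Finset Complex Set MeasureTheory Filter Topology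
open scoped BigOperators Real
open Literature.MathematicalPhysics.QuantumFieldTheory.Balaban1983to89
open B4Strip (Strip ofRealVec)
open B4ContourShift (BZ phase integrand fourierBox latticeKernel StripRegular supNorm latticeKernel_decay ofRealVec_insertNth
  abs_le_supNorm supNorm_nonneg openRect ofRealVec_mem_Strip stripRegular_const)
open B12Sec2to5 (l1 l1_nonneg summable_exp_neg_l1 majorant_summable)
open Summit.QuantumFields.BalabanUV.Beta.FP.CoarseCovarianceInverseKernel (hasSum_latticeKernel_cexp)
open Summit.QuantumFields.BalabanUV.Beta.FP.BrillouinRadial (zero_mem_BZ)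
open Literature.MathematicalPhysics.QuantumFieldTheory.Balaban1983to89.Beta (l1_le_mul_supNorm)

variable {d : ℕ}

/-! ## §1 Slice moments of a strip-regular symbol (generic) -/

section Generic

variable {A : (Fin (d + 1) → ℂ) → ℂ} {κ M : ℝ}

/-- [folklore] the origin slice point: `i.insertNth 0 (ofRealVec 0) = 0`. -/
theorem insertNth_zero_ofRealVec_zero (i : Fin (d + 1)) : (i.insertNth (0 : ℂ) (ofRealVec (0 : Fin d → ℝ)) : Fin (d + 1) → ℂ) = 0 := by
  funext j
  refine Fin.succAboveCases i ?_ ?_ j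
  · simp [Fin.insertNth_apply_same]
  · intro k; simp [Fin.insertNth_apply_succAbove, ofRealVec]

/-- [folklore] the slice momentum `t e_i` lies in the Brillouin zone for `|t| ≤ π`. -/
theorem insertNth_mem_BZ (i : Fin (d + 1)) {t : ℝ} (ht : |t| ≤ π) : (i.insertNth t (0 : Fin d → ℝ)) ∈ BZ (d + 1) := by
  rw [BZ, Set.mem_Icc]
  constructor
  · intro j
    refine Fin.succAboveCases i ?_ ?_ j
    · simp only [Fin.insertNth_apply_same]; exact (abs_le.mp ht).1
    · intro k; simp only [Fin.insertNth_apply_succAbove, Pi.zero_apply]; exact neg_nonpos.mpr Real.pi_pos.le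
  · intro j
    refine Fin.succAboveCases i ?_ ?_ j
    · simp only [Fin.insertNth_apply_same]; exact (abs_le.mp ht).2
    · intro k; simp only [Fin.insertNth_apply_succAbove, Pi.zero_apply]; exact Real.pi_pos.le

/-- [folklore] **ℓ¹-EXPONENTIAL DECAY of the kernel of a strip-regular symbol**: `‖K m‖ ≤ M·e^{−(κ/(d+1))·|m|₁}`. -/
theorem norm_latticeKernel_le_exp_l1 (hA : StripRegular A κ M) (hκ : 0 ≤ κ) (m : Fin (d + 1) → ℤ) :
    ‖latticeKernel A m‖ ≤ M * Real.exp (-(κ / (d + 1)) * l1 m) := by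
  have hM : 0 ≤ M := le_trans (norm_nonneg _) (hA.bound 0 (by
    intro μ; simp [Real.pi_pos.le, hκ]))
  refine (latticeKernel_decay hA hκ m).trans (mul_le_mul_of_nonneg_left (Real.exp_le_exp.mpr ?_) hM)
  have hd : (0 : ℝ) < d + 1 := by positivity
  have := l1_le_mul_supNorm m
  have : κ / (d + 1) * l1 m ≤ κ * supNorm m := by
    rw [div_mul_eq_mul_div, div_le_iff₀ hd]
    calc κ * l1 m ≤ κ * ((d + 1) * supNorm m) := mul_le_mul_of_nonneg_left this hκ
      _ = κ * supNorm m * (d + 1) := by ring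
  linarith

/-- [folklore] **SUMMABILITY OF THE SECOND ABSOLUTE MOMENT** of the kernel of a strip-regular symbol (`κ > 0`): `Σ_m ‖K m‖·(|m|₁² + 1) < ∞`. -/
theorem summable_norm_latticeKernel_mul_sq (hA : StripRegular A κ M) (hκ : 0 < κ) :
    Summable fun m : Fin (d + 1) → ℤ => ‖latticeKernel A m‖ * (l1 m ^ 2 + 1) := by
  have hc : 0 < κ / (d + 1) := div_pos hκ (by positivity)
  have hM : 0 ≤ M := le_trans (norm_nonneg _) (hA.bound 0 (by intro μ; simp [Real.pi_pos.le, hκ.le]))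
  have hmaj : Summable fun m : Fin (d + 1) → ℤ =>
      M * (l1 m ^ 2 * Real.exp (-(κ / (d + 1)) * l1 m) + Real.exp (-(κ / (d + 1)) * l1 m)) :=
    ((majorant_summable hc (d + 1)).add (summable_exp_neg_l1 hc (d + 1))).mul_left M
  refine Summable.of_nonneg_of_le (fun m => by positivity) (fun m => ?_) hmaj
  have h := norm_latticeKernel_le_exp_l1 hA hκ.le m
  have h1 : 0 ≤ l1 m ^ 2 + 1 := by positivity
  calc ‖latticeKernel A m‖ * (l1 m ^ 2 + 1) ≤ M * Real.exp (-(κ / (d + 1)) * l1 m) * (l1 m ^ 2 + 1) :=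
        mul_le_mul_of_nonneg_right h h1
    _ = M * (l1 m ^ 2 * Real.exp (-(κ / (d + 1)) * l1 m) + Real.exp (-(κ / (d + 1)) * l1 m)) := by ring

/-- [folklore] `|m_i| ≤ |m|₁² + 1` and `|m_i|² ≤ |m|₁² + 1` (crude polynomial domination used for the derivative majorants). -/
theorem abs_coord_le (m : Fin (d + 1) → ℤ) (i : Fin (d + 1)) :
    |(m i : ℝ)| ≤ l1 m ^ 2 + 1 ∧ |(m i : ℝ)| ^ 2 ≤ l1 m ^ 2 + 1 := by
  have h1 : |(m i : ℝ)| ≤ l1 m := by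
    unfold l1; exact Finset.single_le_sum (f := fun μ => |(m μ : ℝ)|) (fun μ _ => abs_nonneg _) (Finset.mem_univ i)
  have h0 : 0 ≤ |(m i : ℝ)| := abs_nonneg _
  constructor
  · nlinarith [sq_nonneg (l1 m - 1)]
  · nlinarith

/-- [folklore] **THE FOURIER SERIES ON THE COORDINATE SLICE**: for `|t| ≤ π`, `Σ_m K m·e^{−i t m_i} = A(t e_i)` where `t e_i = i.insertNth t 0`. -/
theorem hasSum_latticeKernel_slice (hA : StripRegular A κ M) (hκ : 0 < κ) (i : Fin (d + 1)) {t : ℝ} (ht : |t| ≤ π) :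
    HasSum (fun m : Fin (d + 1) → ℤ => latticeKernel A m * cexp (-(I * ((t : ℂ) * (m i : ℂ)))))
      (A (i.insertNth (t : ℂ) (ofRealVec 0))) := by
  have h := hasSum_latticeKernel_cexp hA hκ (insertNth_mem_BZ i ht)
  rw [ofRealVec_insertNth] at h
  refine h.congr_fun fun m => ?_
  rw [B4ContourShift.phase_insertNth]
  simp [phase]

/-- [folklore] **ZEROTH MOMENT = VALUE AT THE ORIGIN**: `Σ_m K m = A 0`. -/
theorem hasSum_latticeKernel_zero (hA : StripRegular A κ M) (hκ : 0 < κ) :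
    HasSum (fun m : Fin (d + 1) → ℤ => latticeKernel A m) (A 0) := by
  have h := hasSum_latticeKernel_slice hA hκ 0 (t := 0) (by simp [Real.pi_pos.le])
  rw [Complex.ofReal_zero, insertNth_zero_ofRealVec_zero] at h
  refine h.congr_fun fun m => ?_
  simp

/-- [folklore] the termwise derivative majorants are summable. -/
theorem summable_majorant (hA : StripRegular A κ M) (hκ : 0 < κ) :
    Summable fun m : Fin (d + 1) → ℤ => ‖latticeKernel A m‖ * (l1 m ^ 2 + 1) :=
  summable_norm_latticeKernel_mul_sq hA hκ

/-- [folklore] **FIRST TERMWISE DERIVATIVE** of the slice Fourier series: with `F t := Σ_m K m e^{−itm_i}`,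
`F′(t) = Σ_m K m·(−i m_i)·e^{−itm_i}` for every real `t`. -/
theorem hasDerivAt_sliceSeries (hA : StripRegular A κ M) (hκ : 0 < κ) (i : Fin (d + 1)) (t : ℝ) :
    HasDerivAt (fun s : ℝ => ∑' m : Fin (d + 1) → ℤ, latticeKernel A m * cexp (-(I * ((s : ℂ) * (m i : ℂ)))))
      (∑' m : Fin (d + 1) → ℤ, latticeKernel A m * (-(I * (m i : ℂ))) * cexp (-(I * ((t : ℂ) * (m i : ℂ))))) t := by
  have hu := summable_majorant hA hκ
  refine hasDerivAt_tsum (g := fun (m : Fin (d + 1) → ℤ) (s : ℝ) => latticeKernel A m * cexp (-(I * ((s : ℂ) * (m i : ℂ)))))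
    (g' := fun (m : Fin (d + 1) → ℤ) (s : ℝ) => latticeKernel A m * (-(I * (m i : ℂ))) * cexp (-(I * ((s : ℂ) * (m i : ℂ)))))
    hu (fun m s => ?_) (fun m s => ?_) (y₀ := 0) ?_ t
  · -- termwise derivative
    have h1 : HasDerivAt (fun s : ℝ => -(I * ((s : ℂ) * (m i : ℂ)))) (-(I * (1 * (m i : ℂ)))) s := by
      have h0 : HasDerivAt (fun s : ℝ => (s : ℂ) * (m i : ℂ)) (1 * (m i : ℂ)) s := ((hasDerivAt_id s).ofReal_comp).mul_const (m i : ℂ)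
      have h0' := h0.const_mul (-I)
      have hfun : (fun s : ℝ => -(I * ((s : ℂ) * (m i : ℂ)))) = fun s : ℝ => (-I) * ((s : ℂ) * (m i : ℂ)) := by funext s; ring
      rw [hfun]
      exact h0'.congr_deriv (by rw [neg_mul])
    have h2 := (h1.cexp).const_mul (latticeKernel A m)
    simpa [mul_comm, mul_assoc, mul_left_comm] using h2
  · -- majorant
    rw [norm_mul, norm_mul, Complex.norm_exp]
    have hre : (-(I * ((s : ℂ) * (m i : ℂ)))).re = 0 := by simp
    rw [hre, Real.exp_zero, mul_one, norm_neg, norm_mul, Complex.norm_I, one_mul, Complex.norm_intCast]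
    exact mul_le_mul_of_nonneg_left (abs_coord_le m i).1 (norm_nonneg _)
  · -- summable at 0
    refine (hasSum_latticeKernel_zero hA hκ).summable.congr fun m => ?_
    simp

/-- [folklore] **SECOND TERMWISE DERIVATIVE**: `F″(t) = Σ_m K m·(−i m_i)²·e^{−itm_i} = −Σ_m K m·m_i²·e^{−itm_i}`. -/
theorem hasDerivAt_sliceSeries_deriv (hA : StripRegular A κ M) (hκ : 0 < κ) (i : Fin (d + 1)) (t : ℝ) :
    HasDerivAt (fun s : ℝ => ∑' m : Fin (d + 1) → ℤ, latticeKernel A m * (-(I * (m i : ℂ))) * cexp (-(I * ((s : ℂ) * (m i : ℂ)))))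
      (∑' m : Fin (d + 1) → ℤ, latticeKernel A m * (-(I * (m i : ℂ))) ^ 2 * cexp (-(I * ((t : ℂ) * (m i : ℂ))))) t := by
  have hu := summable_majorant hA hκ
  refine hasDerivAt_tsum (g := fun (m : Fin (d + 1) → ℤ) (s : ℝ) => latticeKernel A m * (-(I * (m i : ℂ))) * cexp (-(I * ((s : ℂ) * (m i : ℂ)))))
    (g' := fun (m : Fin (d + 1) → ℤ) (s : ℝ) => latticeKernel A m * (-(I * (m i : ℂ))) ^ 2 * cexp (-(I * ((s : ℂ) * (m i : ℂ)))))
    hu (fun m s => ?_) (fun m s => ?_) (y₀ := t) ?_ t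
  · have h1 : HasDerivAt (fun s : ℝ => -(I * ((s : ℂ) * (m i : ℂ)))) (-(I * (1 * (m i : ℂ)))) s := by
      have h0 : HasDerivAt (fun s : ℝ => (s : ℂ) * (m i : ℂ)) (1 * (m i : ℂ)) s := ((hasDerivAt_id s).ofReal_comp).mul_const (m i : ℂ)
      have h0' := h0.const_mul (-I)
      have hfun : (fun s : ℝ => -(I * ((s : ℂ) * (m i : ℂ)))) = fun s : ℝ => (-I) * ((s : ℂ) * (m i : ℂ)) := by funext s; ring
      rw [hfun]
      exact h0'.congr_deriv (by rw [neg_mul])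
    have h2 := (h1.cexp).const_mul (latticeKernel A m * (-(I * (m i : ℂ))))
    simpa [sq, mul_comm, mul_assoc, mul_left_comm] using h2
  · rw [norm_mul, norm_mul, Complex.norm_exp]
    have hre : (-(I * ((s : ℂ) * (m i : ℂ)))).re = 0 := by simp
    rw [hre, Real.exp_zero, mul_one, norm_pow, norm_neg, norm_mul, Complex.norm_I, one_mul, Complex.norm_intCast, sq_abs]
    have := (abs_coord_le m i).2
    rw [sq_abs] at this
    exact mul_le_mul_of_nonneg_left this (norm_nonneg _)
  · refine Summable.of_norm_bounded hu fun m => ?_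
    rw [norm_mul, norm_mul, Complex.norm_exp]
    have hre : (-(I * ((t : ℂ) * (m i : ℂ)))).re = 0 := by simp
    rw [hre, Real.exp_zero, mul_one, norm_neg, norm_mul, Complex.norm_I, one_mul, Complex.norm_intCast]
    exact mul_le_mul_of_nonneg_left (abs_coord_le m i).1 (norm_nonneg _)

/-- [folklore] the open rectangle is open and contains the real points `|t| < π`. -/
theorem ofReal_mem_openRect (hκ : 0 < κ) {t : ℝ} (ht : |t| < π) : (t : ℂ) ∈ openRect κ := by
  rw [openRect, Complex.mem_reProdIm]
  exact ⟨by simpa [abs_lt] using ht, by simp [hκ]⟩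

/-- [folklore] **THE SLICE THROUGH THE ORIGIN IS HOLOMORPHIC NEAR EVERY REAL POINT** `|t| < π`. -/
theorem analyticAt_slice (hA : StripRegular A κ M) (hκ : 0 < κ) (i : Fin (d + 1)) {t : ℝ} (ht : |t| < π) :
    AnalyticAt ℂ (fun z : ℂ => A (i.insertNth z (ofRealVec 0))) (t : ℂ) := by
  have hd := hA.diff i 0 zero_mem_BZ
  have ho : IsOpen (openRect κ) := isOpen_Ioo.reProdIm isOpen_Ioo
  exact hd.analyticAt (ho.mem_nhds (ofReal_mem_openRect hκ ht))

/-- [folklore] **THE SLICE SERIES IS THE SLICE FUNCTION** on `|t| < π`, as an eventual equality near any such `t`. -/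
theorem sliceSeries_eventuallyEq (hA : StripRegular A κ M) (hκ : 0 < κ) (i : Fin (d + 1)) {t : ℝ} (ht : |t| < π) :
    (fun s : ℝ => ∑' m : Fin (d + 1) → ℤ, latticeKernel A m * cexp (-(I * ((s : ℂ) * (m i : ℂ))))) =ᶠ[𝓝 t]
      fun s : ℝ => A (i.insertNth (s : ℂ) (ofRealVec 0)) := by
  have ho : IsOpen {s : ℝ | |s| < π} := isOpen_lt continuous_abs continuous_const
  filter_upwards [ho.mem_nhds ht] with s hs
  exact (hasSum_latticeKernel_slice hA hκ i hs.le).tsum_eq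

/-- [folklore] **FIRST DERIVATIVE IDENTIFIED**: for `|t| < π`, `Σ_m K m·(−i m_i)·e^{−itm_i} = (slice)′(t)`. -/
theorem sliceSeries_deriv_eq (hA : StripRegular A κ M) (hκ : 0 < κ) (i : Fin (d + 1)) {t : ℝ} (ht : |t| < π) :
    ∑' m : Fin (d + 1) → ℤ, latticeKernel A m * (-(I * (m i : ℂ))) * cexp (-(I * ((t : ℂ) * (m i : ℂ)))) =
      deriv (fun z : ℂ => A (i.insertNth z (ofRealVec 0))) (t : ℂ) := by
  have h1 := hasDerivAt_sliceSeries hA hκ i t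
  have h2 : HasDerivAt (fun s : ℝ => A (i.insertNth (s : ℂ) (ofRealVec 0)))
      (deriv (fun z : ℂ => A (i.insertNth z (ofRealVec 0))) (t : ℂ)) t :=
    ((analyticAt_slice hA hκ i ht).differentiableAt.hasDerivAt).comp_ofReal
  exact (h1.congr_of_eventuallyEq (sliceSeries_eventuallyEq hA hκ i ht).symm).unique h2

/-- [folklore] **SECOND DERIVATIVE IDENTIFIED** at the origin: `Σ_m K m·(−i m_i)² = (slice)″(0)`. -/
theorem sliceSeries_deriv_deriv_eq (hA : StripRegular A κ M) (hκ : 0 < κ) (i : Fin (d + 1)) :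
    ∑' m : Fin (d + 1) → ℤ, latticeKernel A m * (-(I * (m i : ℂ))) ^ 2 =
      deriv (deriv (fun z : ℂ => A (i.insertNth z (ofRealVec 0)))) 0 := by
  have hπ : |(0 : ℝ)| < π := by simp [Real.pi_pos]
  have h1 := hasDerivAt_sliceSeries_deriv hA hκ i 0
  simp only [Complex.ofReal_zero, zero_mul, mul_zero, neg_zero, Complex.exp_zero, mul_one] at h1
  -- the derivative series equals `s ↦ (slice)′(s)` near `0`
  have ho : IsOpen {s : ℝ | |s| < π} := isOpen_lt continuous_abs continuous_const
  have heq : (fun s : ℝ => ∑' m : Fin (d + 1) → ℤ, latticeKernel A m * (-(I * (m i : ℂ))) * cexp (-(I * ((s : ℂ) * (m i : ℂ))))) =ᶠ[𝓝 0]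
      fun s : ℝ => deriv (fun z : ℂ => A (i.insertNth z (ofRealVec 0))) (s : ℂ) := by
    filter_upwards [ho.mem_nhds hπ] with s hs
    exact sliceSeries_deriv_eq hA hκ i hs
  have h2 : HasDerivAt (fun s : ℝ => deriv (fun z : ℂ => A (i.insertNth z (ofRealVec 0))) (s : ℂ))
      (deriv (deriv (fun z : ℂ => A (i.insertNth z (ofRealVec 0)))) 0) 0 := by
    have ha := (analyticAt_slice hA hκ i hπ).deriv
    rw [Complex.ofReal_zero] at ha
    have := ha.differentiableAt.hasDerivAt.comp_ofReal
    simpa using this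
  exact (h1.congr_of_eventuallyEq heq.symm).unique h2

/-- [folklore] **FIRST MOMENT** of the kernel in coordinate `i`: `Σ_m K m·m_i = I·(slice)′(0)`. -/
theorem hasSum_latticeKernel_mul_coord (hA : StripRegular A κ M) (hκ : 0 < κ) (i : Fin (d + 1)) :
    HasSum (fun m : Fin (d + 1) → ℤ => latticeKernel A m * (m i : ℂ))
      (I * deriv (fun z : ℂ => A (i.insertNth z (ofRealVec 0))) 0) := by
  have hπ : |(0 : ℝ)| < π := by simp [Real.pi_pos]
  have hsum : Summable fun m : Fin (d + 1) → ℤ => latticeKernel A m * (m i : ℂ) := by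
    refine Summable.of_norm_bounded (summable_majorant hA hκ) fun m => ?_
    rw [norm_mul, Complex.norm_intCast]
    exact mul_le_mul_of_nonneg_left (abs_coord_le m i).1 (norm_nonneg _)
  have h := sliceSeries_deriv_eq hA hκ i hπ
  simp only [Complex.ofReal_zero, zero_mul, mul_zero, neg_zero, Complex.exp_zero, mul_one] at h
  have e : ∑' m : Fin (d + 1) → ℤ, latticeKernel A m * (-(I * (m i : ℂ))) = -I * ∑' m : Fin (d + 1) → ℤ, latticeKernel A m * (m i : ℂ) := by
    rw [← tsum_mul_left]; exact tsum_congr fun m => by ring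
  rw [e] at h
  have : ∑' m : Fin (d + 1) → ℤ, latticeKernel A m * (m i : ℂ) = I * deriv (fun z : ℂ => A (i.insertNth z (ofRealVec 0))) 0 := by
    have hI : (-I : ℂ) * I = 1 := by rw [neg_mul, Complex.I_mul_I, neg_neg]
    calc ∑' m : Fin (d + 1) → ℤ, latticeKernel A m * (m i : ℂ)
        = (-I * I) * ∑' m : Fin (d + 1) → ℤ, latticeKernel A m * (m i : ℂ) := by rw [hI, one_mul]
      _ = I * (-I * ∑' m : Fin (d + 1) → ℤ, latticeKernel A m * (m i : ℂ)) := by ring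
      _ = _ := by rw [h]
  rw [← this]
  exact hsum.hasSum

/-- [folklore] **PURE SECOND MOMENT** of the kernel in coordinate `i`: `Σ_m K m·m_i² = −(slice)″(0)`. -/
theorem hasSum_latticeKernel_mul_coord_sq (hA : StripRegular A κ M) (hκ : 0 < κ) (i : Fin (d + 1)) :
    HasSum (fun m : Fin (d + 1) → ℤ => latticeKernel A m * (m i : ℂ) ^ 2)
      (-deriv (deriv (fun z : ℂ => A (i.insertNth z (ofRealVec 0)))) 0) := by
  have hsum : Summable fun m : Fin (d + 1) → ℤ => latticeKernel A m * (m i : ℂ) ^ 2 := by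
    refine Summable.of_norm_bounded (summable_majorant hA hκ) fun m => ?_
    rw [norm_mul, norm_pow, Complex.norm_intCast, sq_abs]
    have := (abs_coord_le m i).2
    rw [sq_abs] at this
    exact mul_le_mul_of_nonneg_left this (norm_nonneg _)
  have h := sliceSeries_deriv_deriv_eq hA hκ i
  have e : ∑' m : Fin (d + 1) → ℤ, latticeKernel A m * (-(I * (m i : ℂ))) ^ 2 = -∑' m : Fin (d + 1) → ℤ, latticeKernel A m * (m i : ℂ) ^ 2 := by
    rw [← tsum_neg]; refine tsum_congr fun m => ?_
    rw [neg_sq, mul_pow, Complex.I_sq]; ring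
  rw [e, neg_eq_iff_eq_neg] at h
  rw [← h]
  exact hsum.hasSum

end Generic

end Summit.QuantumFields.BalabanUV.Beta.FP.LatticeKernelSliceMoments

end
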